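import Summits.ValiantsHypothesis.ValiantsHypothesis.Theorems.FifoMatchingNNDivisionHardLocalization

/-!
# FifoMatching · NNDivisionHard — localization, part 2/4: §5 QUIET corners, §6 DELETION-LOCATED families (`DelLocated`, decided)

Theorems-grade port (bytes staged by val-idea-43 g5 for a port hand) of the crux workfile `Cruxes/NNDivisionHard/Localization43.lean` rev 5
@6763e14e8ba5 (val-idea-43 g5, W6-P2 co-seat; crux `stmt-ValiantsHypothesis-21181` `FifoMatching.NNDivisionHard`; crit-9 g2 V#47 / V#53 VERIFIED KEEP) —
the full commentary (enemy readings N19–N23, currency remarks, honest weight) stays in that workfile's module docstring; statements and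
proofs below are VERBATIM, the namespace is `…Theorems.FifoMatching.Localization` and `T` is a local `abbrev` δ-equal to `XcDivision.T`.

Part 2: §5 `Quiet`, `quietCorner_decided`; §6 `DelLocated` (a functional tight on a deletion face with a unique optimal passenger
vertex; instances `delLocated_of_entryMin`, `delLocated_of_colTilt`), ★★ `delLocated_decided`, `delLocatedCorner_decided`, N21 `enemy_not_delLocated`.
-/

set_option linter.unusedVariables false
set_option linter.unusedSectionVars false
set_option linter.dupNamespace false

namespace Summit.ValiantsHypothesis.ValiantsHypothesis.Theorems.FifoMatching.Localization

open Matrix Finset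
open scoped Pointwise
open Literature.Barriers.PneNP (HasEFOfSize corPolytopeGraph_top_two_pow_half_le)
open Literature.Combinatorics.Optimization (corPolytopeGraph corVec corVec_apply_diag corVec_apply_adj corVec_zero_or_one)
open Summit.ValiantsHypothesis.ValiantsHypothesis.Theorems.FifoMatching (XcDivision.dot_le_of_mem_convexHull XcDivision.convexHull_range_inter_eq)
open Summit.ValiantsHypothesis.ValiantsHypothesis.Theorems.FifoMatching.CorSandwich (threshold_lt_of_rpow_bound)

/-! ## §5 A sorry-free instance with no class of the line: QUIET CORNERS -/

/-- **CLASS `Quiet`** — constant generator families (the passenger is a point).  `Quiet ⊆ F ⊆ S`, `Quiet ⊆ K`. -/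
def Quiet : PClass := fun _ _ q => ∀ j, q j = q 0

/-- the passenger hull of a QUIET family is the single point `q 0`. -/
theorem hull_range_of_quiet {h K : ℕ} (q : Fam h K) (hq : Quiet h K q) : convexHull ℝ (Set.range q) = {q 0} := by
  have e : Set.range q = {q 0} := by
    ext y
    constructor
    · rintro ⟨j, rfl⟩
      exact hq j
    · rintro rfl
      exact ⟨0, rfl⟩
  rw [e, convexHull_singleton]

/-- `√h ≤ h/2` for `h ≥ 4` (real form). -/
theorem rpow_half_le_half {h : ℕ} (hh : 4 ≤ h) : (h : ℝ) ^ (1 / 2 : ℝ) ≤ (h : ℝ) / 2 := by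
  rw [← Real.sqrt_eq_rpow]
  have h4 : (4 : ℝ) ≤ h := by exact_mod_cast hh
  have hs4 : Real.sqrt 4 = 2 := by
    rw [show (4 : ℝ) = 2 ^ 2 by norm_num, Real.sqrt_sq (by norm_num)]
  have hs : (2 : ℝ) ≤ Real.sqrt h := hs4 ▸ Real.sqrt_le_sqrt h4
  have hm : Real.sqrt h * Real.sqrt h = h := Real.mul_self_sqrt (by positivity)
  nlinarith [hs, Real.sqrt_nonneg (h : ℝ)]

/-- ★ **`Quiet` is DECIDED** (`COR(K_h)` + point: Kaibel–Weltge `2^{h/2} ≤ r`, then the route threshold). -/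
theorem quiet_decided : Decided Quiet := by
  intro c
  obtain ⟨h₀, hh₀⟩ := threshold_lt_of_rpow_bound c (by norm_num : (0 : ℝ) < 1 / 2)
  refine ⟨h₀ + 4, fun h hh K q r hq hEF => ?_⟩
  have h4 : 4 ≤ h := by omega
  rw [hull_range_of_quiet q hq, Set.add_singleton] at hEF
  have hCOR : HasEFOfSize (corPolytopeGraph (⊤ : SimpleGraph (Fin h))) r := by
    have h1 := hEF.image_add_const (-(q 0))
    rw [Set.image_image] at h1
    simpa using h1
  have hb : (2 : ℝ) ^ ((h : ℝ) / 2) ≤ r := corPolytopeGraph_top_two_pow_half_le h4 hCOR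
  have hb' : (2 : ℝ) ^ ((h : ℝ) ^ (1 / 2 : ℝ)) ≤ r :=
    le_trans (Real.rpow_le_rpow_of_exponent_le (by norm_num) (rpow_half_le_half h4)) hb
  exact hh₀ h (by omega) r hb'

/-- ★ **QUIET CORNERS ARE DECIDED**: every passenger family (budgeted or not) that is CONSTANT on some `√h × √h` principal minor makes
`COR(K_h) + conv q` super-quasi-polynomially expensive — whatever it does off the corner. -/
theorem quietCorner_decided : Decided (Loc Quiet) :=
  decided_loc quiet_decided

/-- the unfolded membership test of `Loc Quiet`. -/
theorem loc_quiet_iff {h K : ℕ} (q : Fam h K) :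
    Loc Quiet h K q ↔ ∃ ℓ : ℕ, Nat.sqrt h ≤ ℓ ∧ ∃ ι : Fin ℓ ↪ Fin h, ∀ j (i i' : Fin ℓ), q j (ι i, ι i') = q 0 (ι i, ι i') := by
  unfold Loc LocAt Quiet
  constructor
  · rintro ⟨ℓ, hℓ, ι, hq⟩
    refine ⟨ℓ, hℓ, ι, fun j i i' => ?_⟩
    have := congrFun (hq j) (i, i')
    exact this
  · rintro ⟨ℓ, hℓ, ι, hq⟩
    refine ⟨ℓ, hℓ, ι, fun j => ?_⟩
    funext ii'
    obtain ⟨i, i'⟩ := ii'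
    exact hq j i i'

/-- the residual law relative to quiet corners alone already has the COR-VIRTUAL shape (sanity instance of the glue). -/
example (hR : ResidualLaw (Loc Quiet)) : CorVirtualHard :=
  corVirtualHard_of_residualLaw quietCorner_decided hR

/-! ## §6 DELETION-LOCATED families (crit-9 g2 N20 (P2), typed in the face currency)

A functional `C` valid on `COR(K_h)` whose tight set CONTAINS a whole DELETION FACE `{b : b_{x₀} = 0}` and which has a UNIQUE
maximising passenger point locates the pair on `Del_{x₀} + {q_{j₀}} ≅ COR(K_{h−1}) + point` — read through the deletion minor
`π_{succAbove x₀}` of §1 and priced by Kaibel–Weltge.  Instances: a UNIQUE MINIMISER OF ONE MATRIX ENTRY among the generators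
(`delLocated_of_entryMin`, functional `−E_{xx'}`; this is what kills crit-9's `Q∘` «with one entry»), and the NEGATIVE COLUMN TILT
`W = −Σ_l M_l E_{l x₀}`, `M ≥ 0` (`delLocated_of_colTilt`; N20's «single-column negative tilt» on affine cubes with a tilt-live column).
Mirror image of the line's CLASS W `SwitchLocated` (tight set = the switched face `{b_a = 1}` EXACTLY) under the switching symmetry of
`COR`; not inside G `DiagFacePoor` (diagonal directions only) nor E♭ (admissible directions vanish on block-constant `b`, which include `𝟙`). -/

/-- **CLASS `DelLocated` — DELETION-LOCATED passenger families.** -/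
def DelLocated : PClass := fun h K q =>
  ∃ (x₀ : Fin h) (C : Fin h × Fin h → ℝ) (M : ℝ),
    (∀ b : Fin h → Bool, C ⬝ᵥ corVec (⊤ : SimpleGraph (Fin h)) b ≤ M) ∧
    (∀ b : Fin h → Bool, b x₀ = false → C ⬝ᵥ corVec (⊤ : SimpleGraph (Fin h)) b = M) ∧
      ∃ j₀ : Fin (K + 1), ∀ j, C ⬝ᵥ q j < C ⬝ᵥ q j₀ ∨ q j = q j₀

/-- the DELETION FACE of `COR(K_h)` at `x₀`: `conv {bbᵀ : b_{x₀} = 0}`. -/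
def delFace (h : ℕ) (x₀ : Fin h) : Set (Fin h × Fin h → ℝ) :=
  convexHull ℝ (Set.range fun b : {b : Fin h → Bool // b x₀ = false} => corVec (⊤ : SimpleGraph (Fin h)) b.1)

/-- the single-entry functional `−E_{p₀}`. -/
def negEntry {h : ℕ} (p₀ : Fin h × Fin h) : Fin h × Fin h → ℝ := fun p => if p = p₀ then -1 else 0

/-- `negEntry p₀ ⬝ y = −y p₀`. -/
theorem negEntry_dotProduct {h : ℕ} (p₀ : Fin h × Fin h) (y : Fin h × Fin h → ℝ) : negEntry p₀ ⬝ᵥ y = -y p₀ := by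
  unfold negEntry dotProduct
  simp [ite_mul, Finset.sum_ite_eq']

/-- the NEGATIVE COLUMN TILT `W = −Σ_l M_l E_{l x₀}` (crit-9 g2 N20). -/
def colTilt {h : ℕ} (x₀ : Fin h) (Mv : Fin h → ℝ) : Fin h × Fin h → ℝ := fun p => if p.2 = x₀ then -(Mv p.1) else 0

/-- `colTilt x₀ Mv ⬝ y = −Σ_l Mv l · y (l, x₀)` (a nonnegative tilt of column `x₀`, read with a minus sign). -/
theorem colTilt_dotProduct {h : ℕ} (x₀ : Fin h) (Mv : Fin h → ℝ) (y : Fin h × Fin h → ℝ) :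
    colTilt x₀ Mv ⬝ᵥ y = -∑ l, Mv l * y (l, x₀) := by
  unfold colTilt dotProduct
  rw [Fintype.sum_prod_type]
  simp [ite_mul, Finset.sum_ite_eq', Finset.sum_neg_distrib]

/-- entries of a vertex `bbᵀ` of `COR(K_h)`: `(bbᵀ)(x,x') = [b x ∧ b x']`. -/
theorem corVec_top_apply {h : ℕ} (b : Fin h → Bool) (x x' : Fin h) :
    corVec (⊤ : SimpleGraph (Fin h)) b (x, x') = if (b x && b x') then 1 else 0 := by
  by_cases hx : x = x'
  · subst hx
    rw [corVec_apply_diag, Bool.and_self]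
  · exact corVec_apply_adj _ b ((SimpleGraph.top_adj x x').2 hx)

/-- vertices of `COR(K_h)` have nonnegative entries. -/
theorem corVec_top_nonneg {h : ℕ} (b : Fin h → Bool) (p : Fin h × Fin h) : 0 ≤ corVec (⊤ : SimpleGraph (Fin h)) b p := by
  rcases corVec_zero_or_one ⊤ b p with h1 | h1 <;> simp [h1]

/-- `(bbᵀ)(x,x') = 0` when `b x = false`. -/
theorem corVec_top_eq_zero_of_fst {h : ℕ} (b : Fin h → Bool) {x : Fin h} (x' : Fin h) (hx : b x = false) :
    corVec (⊤ : SimpleGraph (Fin h)) b (x, x') = 0 := by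
  rw [corVec_top_apply]; simp [hx]

/-- `(bbᵀ)(x,x') = 0` when `b x' = false`. -/
theorem corVec_top_eq_zero_of_snd {h : ℕ} (b : Fin h → Bool) (x : Fin h) {x' : Fin h} (hx' : b x' = false) :
    corVec (⊤ : SimpleGraph (Fin h)) b (x, x') = 0 := by
  rw [corVec_top_apply]; simp [hx']

/-- ★ **UNIQUE ENTRY MINIMISER ⇒ deletion-located**: if the matrix entry `(x, x')` attains its minimum over the generator list at a
unique generator POINT, the family is `DelLocated` (functional `−E_{xx'}`, tight on `{b : b_x b_{x'} = 0} ⊇ {b_x = 0}`). -/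
theorem delLocated_of_entryMin {h K : ℕ} (q : Fam h K) (x x' : Fin h) (j₀ : Fin (K + 1))
    (hmin : ∀ j, q j₀ (x, x') < q j (x, x') ∨ q j = q j₀) : DelLocated h K q := by
  refine ⟨x, negEntry (x, x'), 0, fun b => ?_, fun b hb => ?_, j₀, fun j => ?_⟩
  · rw [negEntry_dotProduct]
    have := corVec_top_nonneg b (x, x')
    linarith
  · rw [negEntry_dotProduct, corVec_top_eq_zero_of_fst b x' hb]
    ring
  · rcases hmin j with h1 | h1
    · left
      rw [negEntry_dotProduct, negEntry_dotProduct]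
      linarith
    · right
      exact h1

/-- ★ **NEGATIVE COLUMN TILT ⇒ deletion-located** (crit-9 g2 N20 (P2)): `W = −Σ_l M_l E_{l x₀}` with `M ≥ 0` is valid on `COR(K_h)` with
maximum `0`, attained on the whole deletion face `{b_{x₀} = 0}`; a unique `W`-maximising passenger point then locates the pair.  (On an
affine cube `q_P = q_∅ + Σ_{l ∈ P} D_l` whose column `x₀` is TILT-LIVE — every `D_l` has a nonzero entry in column `x₀` — a generic `M ≥ 0`
makes all `⟨W, D_l⟩ ≠ 0`, hence the maximiser `P* = {l : ⟨W, D_l⟩ > 0}` unique: N20's computation.) -/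
theorem delLocated_of_colTilt {h K : ℕ} (q : Fam h K) (x₀ : Fin h) (Mv : Fin h → ℝ) (hM : ∀ l, 0 ≤ Mv l) (j₀ : Fin (K + 1))
    (huniq : ∀ j, colTilt x₀ Mv ⬝ᵥ q j < colTilt x₀ Mv ⬝ᵥ q j₀ ∨ q j = q j₀) : DelLocated h K q := by
  refine ⟨x₀, colTilt x₀ Mv, 0, fun b => ?_, fun b hb => ?_, j₀, huniq⟩
  · rw [colTilt_dotProduct, neg_nonpos]
    exact Finset.sum_nonneg fun l _ => mul_nonneg (hM l) (corVec_top_nonneg b (l, x₀))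
  · rw [colTilt_dotProduct, neg_eq_zero]
    exact Finset.sum_eq_zero fun l _ => by rw [corVec_top_eq_zero_of_snd b l hb, mul_zero]

/-- the passenger part of the exposed face is the unique maximising point. -/
theorem hull_inter_eq_singleton {h K : ℕ} (q : Fam h K) (C : Fin h × Fin h → ℝ) (j₀ : Fin (K + 1))
    (hj : ∀ j, C ⬝ᵥ q j < C ⬝ᵥ q j₀ ∨ q j = q j₀) :
    convexHull ℝ (Set.range q) ∩ {y | C ⬝ᵥ y = C ⬝ᵥ q j₀} = {q j₀} := by
  have hle : ∀ j, C ⬝ᵥ q j ≤ C ⬝ᵥ q j₀ := fun j => by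
    rcases hj j with h1 | h1
    · exact h1.le
    · rw [h1]
  rw [XcDivision.convexHull_range_inter_eq q C _ hle]
  have hr : Set.range (fun j : {j : Fin (K + 1) // C ⬝ᵥ q j = C ⬝ᵥ q j₀} => q j.1) = {q j₀} := by
    ext y
    simp only [Set.mem_range, Set.mem_singleton_iff]
    constructor
    · rintro ⟨⟨j, hj'⟩, rfl⟩
      rcases hj j with h1 | h1
      · exact absurd hj' h1.ne
      · exact h1
    · rintro rfl
      exact ⟨⟨j₀, rfl⟩, rfl⟩
  rw [hr, convexHull_singleton]

/-- the `COR` part of the exposed face is the hull of the tight vertices. -/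
theorem cor_inter_eq {h : ℕ} (C : Fin h × Fin h → ℝ) (M : ℝ) (hC : ∀ b : Fin h → Bool, C ⬝ᵥ corVec (⊤ : SimpleGraph (Fin h)) b ≤ M) :
    corPolytopeGraph (⊤ : SimpleGraph (Fin h)) ∩ {x | C ⬝ᵥ x = M} =
      convexHull ℝ (Set.range fun b : {b : Fin h → Bool // C ⬝ᵥ corVec (⊤ : SimpleGraph (Fin h)) b = M} =>
        corVec (⊤ : SimpleGraph (Fin h)) b.1) := by
  unfold corPolytopeGraph
  exact XcDivision.convexHull_range_inter_eq _ C M hC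

/-- the direction `−E_{x₀x₀}` is valid on `COR(K_h)` with maximum `0`. -/
theorem negDiag_corVec_le {h : ℕ} (x₀ : Fin h) (b : Fin h → Bool) :
    negEntry (x₀, x₀) ⬝ᵥ corVec (⊤ : SimpleGraph (Fin h)) b ≤ 0 := by
  rw [negEntry_dotProduct]
  have := corVec_top_nonneg b (x₀, x₀)
  linarith

/-- inside the tight set of `C`, the functional `−E_{x₀x₀}` cuts out exactly the deletion face. -/
theorem corFace_inter_negDiag_eq_delFace {h : ℕ} (x₀ : Fin h) (C : Fin h × Fin h → ℝ) (M : ℝ)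
    (hdel : ∀ b : Fin h → Bool, b x₀ = false → C ⬝ᵥ corVec (⊤ : SimpleGraph (Fin h)) b = M) :
    convexHull ℝ (Set.range fun b : {b : Fin h → Bool // C ⬝ᵥ corVec (⊤ : SimpleGraph (Fin h)) b = M} =>
        corVec (⊤ : SimpleGraph (Fin h)) b.1) ∩ {x | negEntry (x₀, x₀) ⬝ᵥ x = 0} = delFace h x₀ := by
  have hle : ∀ b : {b : Fin h → Bool // C ⬝ᵥ corVec (⊤ : SimpleGraph (Fin h)) b = M},
      negEntry (x₀, x₀) ⬝ᵥ corVec (⊤ : SimpleGraph (Fin h)) b.1 ≤ 0 := fun b => negDiag_corVec_le x₀ b.1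
  rw [XcDivision.convexHull_range_inter_eq _ (negEntry (x₀, x₀)) 0 hle]
  unfold delFace
  congr 1
  ext y
  simp only [Set.mem_range]
  constructor
  · rintro ⟨⟨⟨b, hbM⟩, hb0⟩, rfl⟩
    refine ⟨⟨b, ?_⟩, rfl⟩
    rw [negEntry_dotProduct, corVec_top_apply] at hb0
    cases hx : b x₀
    · rfl
    · simp [hx] at hb0
  · rintro ⟨⟨b, hb⟩, rfl⟩
    refine ⟨⟨⟨b, hdel b hb⟩, ?_⟩, rfl⟩
    show negEntry (x₀, x₀) ⬝ᵥ corVec ⊤ b = 0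
    rw [negEntry_dotProduct, corVec_top_eq_zero_of_fst b x₀ hb]
    ring

/-- ★ the deletion MINOR maps the deletion FACE onto `COR(K_n)` (`§1` restricted to the face, where the read is injective). -/
theorem delRead_image_delFace {n : ℕ} (x₀ : Fin (n + 1)) :
    delRead (Fin.succAboveEmb x₀) '' delFace (n + 1) x₀ = corPolytopeGraph (⊤ : SimpleGraph (Fin n)) := by
  unfold delFace corPolytopeGraph
  rw [LinearMap.image_convexHull, ← Set.range_comp]
  congr 1
  ext y
  constructor
  · rintro ⟨⟨b, hb⟩, rfl⟩
    exact ⟨b ∘ Fin.succAboveEmb x₀, (delRead_corVec _ b).symm⟩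
  · rintro ⟨a, rfl⟩
    refine ⟨⟨Function.extend (Fin.succAboveEmb x₀) a (fun _ => false), ?_⟩, ?_⟩
    · refine Function.extend_apply' _ _ _ ?_
      rintro ⟨i, hi⟩
      exact Fin.succAbove_ne x₀ i hi
    · show delRead _ (corVec ⊤ _) = corVec ⊤ a
      rw [delRead_corVec]
      congr 1
      funext p
      show Function.extend (⇑(Fin.succAboveEmb x₀)) a (fun _ => false) ((Fin.succAboveEmb x₀) p) = a p
      exact (Fin.succAboveEmb x₀).injective.extend_apply _ _ p

/-- `√(n+1) ≤ n/2` for `n ≥ 8`. -/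
theorem rpow_half_succ_le {n : ℕ} (hn : 8 ≤ n) : ((n + 1 : ℕ) : ℝ) ^ (1 / 2 : ℝ) ≤ (n : ℝ) / 2 := by
  rw [← Real.sqrt_eq_rpow]
  have h8 : (8 : ℝ) ≤ n := by exact_mod_cast hn
  have hsq : ((n + 1 : ℕ) : ℝ) ≤ ((n : ℝ) / 2) ^ 2 := by
    push_cast
    nlinarith
  calc Real.sqrt ((n + 1 : ℕ) : ℝ) ≤ Real.sqrt (((n : ℝ) / 2) ^ 2) := Real.sqrt_le_sqrt hsq
    _ = (n : ℝ) / 2 := Real.sqrt_sq (by positivity)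

/-- ★★ **CLASS `DelLocated` IS DECIDED** (two exposed-face cuts `face_add_face₁`, the deletion minor `delRead (succAbove x₀)` of §1,
Kaibel–Weltge on `COR(K_{h−1})`, the route threshold). -/
theorem delLocated_decided : Decided DelLocated := by
  intro c
  obtain ⟨h₀, hh₀⟩ := threshold_lt_of_rpow_bound c (by norm_num : (0 : ℝ) < 1 / 2)
  refine ⟨h₀ + 9, fun h hh K q r hq hEF => ?_⟩
  obtain ⟨x₀, C, M, hCle, hCdel, j₀, hj₀⟩ := hq
  obtain ⟨n, rfl⟩ : ∃ n, h = n + 1 := ⟨h - 1, by omega⟩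
  have hn : 8 ≤ n := by omega
  -- step 1: the exposed face of the pair in direction `C`
  have hP : ∀ x ∈ corPolytopeGraph (⊤ : SimpleGraph (Fin (n + 1))), C ⬝ᵥ x ≤ M := by
    unfold corPolytopeGraph
    refine XcDivision.dot_le_of_mem_convexHull _ C M ?_
    rintro _ ⟨b, rfl⟩
    exact hCle b
  have hle : ∀ j, C ⬝ᵥ q j ≤ C ⬝ᵥ q j₀ := fun j => by
    rcases hj₀ j with h1 | h1
    · exact h1.le
    · rw [h1]
  have hR : ∀ y ∈ convexHull ℝ (Set.range q), C ⬝ᵥ y ≤ C ⬝ᵥ q j₀ :=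
    XcDivision.dot_le_of_mem_convexHull _ C _ (by rintro _ ⟨j, rfl⟩; exact hle j)
  have h1 := hEF.face_add_face₁ C M (C ⬝ᵥ q j₀) hP hR
  rw [hull_inter_eq_singleton q C j₀ hj₀, cor_inter_eq C M hCle] at h1
  -- step 2: the deletion face inside it, direction `−E_{x₀x₀}`
  have hP' : ∀ x ∈ convexHull ℝ (Set.range fun b : {b : Fin (n + 1) → Bool //
      C ⬝ᵥ corVec (⊤ : SimpleGraph (Fin (n + 1))) b = M} => corVec (⊤ : SimpleGraph (Fin (n + 1))) b.1),
      negEntry (x₀, x₀) ⬝ᵥ x ≤ 0 :=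
    XcDivision.dot_le_of_mem_convexHull _ _ _ (by rintro _ ⟨b, rfl⟩; exact negDiag_corVec_le x₀ b.1)
  have hR' : ∀ y ∈ ({q j₀} : Set (Fin (n + 1) × Fin (n + 1) → ℝ)),
      negEntry (x₀, x₀) ⬝ᵥ y ≤ negEntry (x₀, x₀) ⬝ᵥ q j₀ := by
    intro y hy
    rw [Set.mem_singleton_iff.1 hy]
  have h2 := h1.face_add_face₁ (negEntry (x₀, x₀)) 0 (negEntry (x₀, x₀) ⬝ᵥ q j₀) hP' hR'
  rw [corFace_inter_negDiag_eq_delFace x₀ C M hCdel] at h2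
  have hsing : ({q j₀} : Set (Fin (n + 1) × Fin (n + 1) → ℝ)) ∩
      {y | negEntry (x₀, x₀) ⬝ᵥ y = negEntry (x₀, x₀) ⬝ᵥ q j₀} = {q j₀} := by
    ext y
    simp only [Set.mem_inter_iff, Set.mem_singleton_iff, Set.mem_setOf_eq]
    constructor
    · rintro ⟨rfl, -⟩
      rfl
    · rintro rfl
      exact ⟨rfl, rfl⟩
  rw [hsing] at h2
  -- step 3: read the deletion minor at `x₀`
  have h3 := h2.image_linearMap (delRead (Fin.succAboveEmb x₀))
  rw [Set.image_add, delRead_image_delFace, Set.image_singleton] at h3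
  -- step 4: translate the point away; Kaibel–Weltge on `COR(K_n)`
  have hCOR : HasEFOfSize (corPolytopeGraph (⊤ : SimpleGraph (Fin n))) r := by
    rw [Set.add_singleton] at h3
    have h4 := h3.image_add_const (-(delRead (Fin.succAboveEmb x₀) (q j₀)))
    rw [Set.image_image] at h4
    simpa using h4
  have hb : (2 : ℝ) ^ ((n : ℝ) / 2) ≤ r := corPolytopeGraph_top_two_pow_half_le (by omega) hCOR
  have hb' : (2 : ℝ) ^ (((n + 1 : ℕ) : ℝ) ^ (1 / 2 : ℝ)) ≤ r :=
    le_trans (Real.rpow_le_rpow_of_exponent_le (by norm_num) (rpow_half_succ_le hn)) hb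
  exact hh₀ (n + 1) (by omega) r hb'

/-- ★ hence: a unique minimiser of ONE matrix entry among the generators already forces `> T c h`. -/
theorem entryMin_decided :
    Decided (fun h K q => ∃ (x x' : Fin h) (j₀ : Fin (K + 1)), ∀ j, q j₀ (x, x') < q j (x, x') ∨ q j = q j₀) :=
  decided_anti (fun h K q hq => by
    obtain ⟨x, x', j₀, hmin⟩ := hq
    exact delLocated_of_entryMin q x x' j₀ hmin) delLocated_decided

/-- ★ and, by §3, DELETION-LOCATED ON A `√h` CORNER is decided too. -/
theorem delLocatedCorner_decided : Decided (Loc DelLocated) :=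
  decided_loc delLocated_decided

/-- **N21 (enemy side)**: below the threshold, on EVERY deletion minor of size `≥ √h`, NO functional tight on a deletion face has a unique
passenger maximiser — in particular every matrix entry of the read generators attains its minimum at two DISTINCT generator points, and so
does every nonnegative column tilt its maximum. -/
theorem enemy_not_delLocated (c : ℕ) :
    ∃ h₀ : ℕ, ∀ h ≥ h₀, ∀ (K : ℕ) (q : Fam h K) (r : ℕ),
      HasEFOfSize (corPolytopeGraph (⊤ : SimpleGraph (Fin h)) + convexHull ℝ (Set.range q)) r → r ≤ T c h →
      ∀ ℓ : ℕ, Nat.sqrt h ≤ ℓ → ∀ ι : Fin ℓ ↪ Fin h, ¬ DelLocated ℓ K (⇑(delRead ι) ∘ q) :=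
  enemy_hereditary delLocated_decided c

end Summit.ValiantsHypothesis.ValiantsHypothesis.Theorems.FifoMatching.Localization
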